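import Literature.NumberTheory.GaloisRepresentations.GlobalNormGroupCorrespondenceProofs
import Literature.NumberTheory.GaloisRepresentations.IdelicLocalNorm
import Literature.NumberTheory.Automorphic.NormGroupClosedProofs
import HarnessLib

/-!
# Galois equivariance of the Artin map: `ψ_{M|K'}(σ x) = τ ψ_{M|K'}(x) τ⁻¹` (Tate, Cassels–Fröhlich VII 11.5)

Topic `NumberTheory/GaloisRepresentations` (global class field theory); namespace
`Literature.NumberTheory.GaloisRepresentations`.  Proof file with one auxiliary definition
(`conjRestrict`: conjugation of `G(M|K')` by an automorphism `τ` of `M` over the smaller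
field `K`, and its bundled form `conjRestrictHom`); no named fact, no instance (D-0026).

For a tower of number fields `K ⊆ K' ⊆ M` (`K K' M : Type`, `IsScalarTower`), `K'|K` Galois,
`M|K'` finite abelian, and a `K`-automorphism `τ` of `M` (so `σ = τ|_{K'} ∈ G(K'|K)` acts on the
ideles `𝕀_{K'}`, `Automorphic.GaloisActionAdeleRing`), the Artin map
`ψ_{M|K'} = artinIdeleMapOfAlgebra K' M hR : 𝕀_{K'} → G(M|K')` satisfies

> **Tate, Cassels–Fröhlich VII, Thm. 11.5** (first assertion; PDF p. 236), used in §12 (p. 239–240)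
> in the form "`ψ(x) = σ ψ(x) σ⁻¹ = ψ(σ x)` for all `x ∈ C_L` and `σ ∈ E`": the Artin map is
> transported by isomorphisms of fields — for `τ ∈ Aut_K(M)`,
> `ψ_{M|K'}(τ|_{K'} · x) = τ ∘ ψ_{M|K'}(x) ∘ τ⁻¹`.

* `conjRestrict τ a = τ ∘ a ∘ τ⁻¹ ∈ G(M|K')` for `a ∈ G(M|K')` (it is again `K'`-linear
  because `τ(K') = K'`), a group automorphism (`conjRestrictHom`), with
  `restrictScalars_conjRestrict : (τ a τ⁻¹)|_K = τ · a|_K · τ⁻¹`;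
* `smul_mem_primesOver`, `isArithFrobAt_conjRestrict`, **`galFrob_galois_smul`** — conjugate primes and
  Frobenius elements: `τ 𝔔 ∣ σ w` and **`Frob_{σ w}(M|K') = τ Frob_w(M|K') τ⁻¹`**
  (Neukirch, *Algebraic Number Theory* I §9);
* `artinIdeleMapOfAlgebra_localUnits_of_valuation_eq` — `ψ_{M|K'}(⟨ϖ⟩_w) = Frob_w` for *any*
  uniformizer `ϖ` at an unramified `w`;
* **`artinIdeleMapOfAlgebra_galois_smul`** — `ψ_{M|K'}(σ • x) = τ ψ_{M|K'}(x) τ⁻¹`, by the uniqueness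
  of the Artin map (`artinIdeleMapOfAlgebra_unique`: `x ↦ τ⁻¹ ψ(σ x) τ` has open kernel, kills `K'ˣ`
  and takes `⟨ϖ_w⟩ ↦ τ⁻¹ Frob_{σ w} τ = Frob_w`); consequences `artinIdeleMapOfAlgebra_galois_smul_eq`
  (**if `M|K` is abelian then `ψ_{M|K'}(σ • x) = ψ_{M|K'}(x)`**) and `smul_mem_normGroup_iff`
  (**the norm group `K'ˣ N_{M|K'} 𝕀_M` is `G(K'|K)`-stable** when `M|K` is Galois).

## References

* J. Tate, *Global class field theory*, Ch. VII in J. W. S. Cassels, A. Fröhlich (eds.), *Algebraic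
  Number Theory*, Academic Press 1967, Thm. 11.5 and §12 (PDF pp. 236, 239–240). [CasselsFrohlichANT1967]
* J. Neukirch, *Algebraic Number Theory*, Grundlehren 322, Springer 1999, Ch. I §9. [NeukirchANT1999]
* J. Neukirch, *Class Field Theory — The Bonn Lectures*, ed. A. Schmidt, Springer 2013, Part III
  (6.13). [Neukirch2013]
-/

noncomputable section

open scoped NumberField Pointwise
open NumberField IsDedekindDomain IsDedekindDomain.HeightOneSpectrum Filter
open Literature.NumberTheory.Automorphic

namespace Literature.NumberTheory.GaloisRepresentations

/-! ### Conjugating `G(M|K')` by automorphisms of `M` over `K ⊆ K'` -/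

section Conj

variable {K : Type*} [Field K] {K' : Type*} [Field K'] [Algebra K K'] {M : Type*} [Field M]
  [Algebra K M] [Algebra K' M] [IsScalarTower K K' M] [Normal K K']

/-- `τ⁻¹` on `K' ⊆ M` is `(τ|_{K'})⁻¹`. [folklore] -/
theorem symm_algebraMap_eq (τ : M ≃ₐ[K] M) (c : K') :
    τ.symm (algebraMap K' M c) = algebraMap K' M ((τ.restrictNormal K').symm c) := by
  apply τ.injective
  rw [AlgEquiv.apply_symm_apply, ← AlgEquiv.restrictNormal_commutes (χ := τ) (E := K'),
    AlgEquiv.apply_symm_apply]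

/-- **Conjugation of `G(M|K')` by `τ ∈ Aut_K(M)`**: `τ ∘ a ∘ τ⁻¹` is again `K'`-linear, because
`τ` maps `K'` onto itself (`K'|K` normal). [folklore] -/
def conjRestrict (τ : M ≃ₐ[K] M) (a : M ≃ₐ[K'] M) : M ≃ₐ[K'] M :=
  { (τ.symm.trans ((a.restrictScalars K).trans τ)) with
    commutes' := fun c => by
      change τ (a (τ.symm (algebraMap K' M c))) = algebraMap K' M c
      rw [symm_algebraMap_eq, a.commutes, ← AlgEquiv.restrictNormal_commutes (χ := τ) (E := K'),
        AlgEquiv.apply_symm_apply] }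

/-- `(τ a τ⁻¹)(m) = τ (a (τ⁻¹ m))`. [folklore] -/
@[simp] theorem conjRestrict_apply (τ : M ≃ₐ[K] M) (a : M ≃ₐ[K'] M) (m : M) :
    conjRestrict τ a m = τ (a (τ.symm m)) := rfl

/-- On `K`-linear maps, `conjRestrict` is conjugation in `Aut_K(M)`. [folklore] -/
theorem AlgEquiv.restrictScalars_conjRestrict (τ : M ≃ₐ[K] M) (a : M ≃ₐ[K'] M) :
    (conjRestrict τ a).restrictScalars K = τ * a.restrictScalars K * τ⁻¹ :=
  AlgEquiv.ext fun _ => rfl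

/-- `conjRestrict τ` is multiplicative. [folklore] -/
theorem conjRestrict_mul (τ : M ≃ₐ[K] M) (a b : M ≃ₐ[K'] M) :
    conjRestrict τ (a * b) = conjRestrict τ a * conjRestrict τ b :=
  AlgEquiv.ext fun m => by
    simp only [AlgEquiv.mul_apply, conjRestrict_apply, AlgEquiv.symm_apply_apply]

/-- `conjRestrict τ 1 = 1`. [folklore] -/
@[simp] theorem conjRestrict_one (τ : M ≃ₐ[K] M) : conjRestrict τ (1 : M ≃ₐ[K'] M) = 1 :=
  AlgEquiv.ext fun m => by simp

/-- **`conjRestrict τ` as a group automorphism's underlying homomorphism** `G(M|K') → G(M|K')`.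
[folklore] -/
def conjRestrictHom (τ : M ≃ₐ[K] M) : (M ≃ₐ[K'] M) →* (M ≃ₐ[K'] M) where
  toFun := conjRestrict τ
  map_one' := conjRestrict_one τ
  map_mul' := conjRestrict_mul τ

/-- Unfolding lemma. [folklore] -/
@[simp] theorem conjRestrictHom_apply (τ : M ≃ₐ[K] M) (a : M ≃ₐ[K'] M) :
    conjRestrictHom τ a = conjRestrict τ a := rfl

/-- `τ (τ⁻¹ a τ) τ⁻¹ = a`. [folklore] -/
@[simp] theorem conjRestrict_conjRestrict_symm (τ : M ≃ₐ[K] M) (a : M ≃ₐ[K'] M) :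
    conjRestrict τ (conjRestrict τ.symm a) = a :=
  AlgEquiv.ext fun m => by simp

/-- `τ⁻¹ (τ a τ⁻¹) τ = a`. [folklore] -/
@[simp] theorem conjRestrict_symm_conjRestrict (τ : M ≃ₐ[K] M) (a : M ≃ₐ[K'] M) :
    conjRestrict τ.symm (conjRestrict τ a) = a :=
  AlgEquiv.ext fun m => by simp

/-- `τ a τ⁻¹ = 1 ↔ a = 1`. [folklore] -/
theorem conjRestrict_eq_one_iff (τ : M ≃ₐ[K] M) (a : M ≃ₐ[K'] M) :
    conjRestrict τ a = 1 ↔ a = 1 := by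
  refine ⟨fun h => ?_, fun h => by rw [h, conjRestrict_one]⟩
  rw [← conjRestrict_symm_conjRestrict τ a, h, conjRestrict_one]

end Conj

/-! ### Conjugate primes and Frobenius elements in the tower `K ⊆ K' ⊆ M` -/

section Frobenius

variable {K : Type} [Field K] {K' : Type} [Field K'] [NumberField K'] [Algebra K K']
  {M : Type} [Field M] [NumberField M] [Algebra K M] [Algebra K' M] [IsScalarTower K K' M]
  [IsGalois K K']

omit [NumberField K'] [NumberField M] in
/-- `τ ∈ Aut_K(M)` acts on `𝓞 K' ⊆ 𝓞 M` through `τ|_{K'}`. [folklore] -/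
theorem smul_algebraMap_ringOfIntegers (τ : M ≃ₐ[K] M) (x : 𝓞 K') :
    τ • (algebraMap (𝓞 K') (𝓞 M) x) = algebraMap (𝓞 K') (𝓞 M) (τ.restrictNormal K' • x) := by
  apply RingOfIntegers.ext
  change τ (algebraMap K' M (x : K')) = algebraMap K' M ((τ.restrictNormal K') (x : K'))
  exact (AlgEquiv.restrictNormal_commutes (χ := τ) (E := K') (x : K')).symm

omit [NumberField K'] [NumberField M] in
/-- `(τ⁻¹)|_{K'} = (τ|_{K'})⁻¹`. [folklore] -/
theorem restrictNormal_inv (τ : M ≃ₐ[K] M) : τ⁻¹.restrictNormal K' = (τ.restrictNormal K')⁻¹ :=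
  map_inv (AlgEquiv.restrictNormalHom K' : (M ≃ₐ[K] M) →* (K' ≃ₐ[K] K')) τ

omit [NumberField K'] [NumberField M] in
/-- **Conjugate primes**: if `𝔔 ∣ w` in `M|K'` then `τ 𝔔 ∣ τ|_{K'} w`.
[cite: NeukirchANT1999, Ch. I §9] -/
theorem smul_mem_primesOver (τ : M ≃ₐ[K] M) {w : HeightOneSpectrum (𝓞 K')} {Q : Ideal (𝓞 M)}
    (hQ : Q ∈ w.asIdeal.primesOver (𝓞 M)) :
    τ • Q ∈ (τ.restrictNormal K' • w).asIdeal.primesOver (𝓞 M) := by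
  obtain ⟨hprime, hover⟩ := hQ
  refine ⟨?_, ⟨?_⟩⟩
  · rw [Ideal.pointwise_smul_eq_comap]
    exact Ideal.comap_isPrime _ _
  · ext x
    rw [HeightOneSpectrum.smul_asIdeal, Ideal.mem_pointwise_smul_iff_inv_smul_mem, Ideal.under_def,
      Ideal.mem_comap, Ideal.mem_pointwise_smul_iff_inv_smul_mem, hover.over, Ideal.under_def,
      Ideal.mem_comap, smul_algebraMap_ringOfIntegers, restrictNormal_inv]

omit [NumberField K'] [NumberField M] in
/-- On `𝓞 M`, `τ a τ⁻¹` acts as `y ↦ τ (a (τ⁻¹ y))`. [folklore] -/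
theorem conjRestrict_smul_ringOfIntegers (τ : M ≃ₐ[K] M) (a : M ≃ₐ[K'] M) (y : 𝓞 M) :
    (conjRestrict τ a) • y = τ • (a • (τ⁻¹ • y)) :=
  RingOfIntegers.ext rfl

variable [FiniteDimensional K' M] [IsAbelianGalois K' M]

omit [NumberField K'] [NumberField M] [FiniteDimensional K' M] [IsAbelianGalois K' M] in
/-- **Frobenius elements of conjugate primes**: if `φ` is an arithmetic Frobenius of `M|K'` at `𝔔`,
then `τ φ τ⁻¹` is one at `τ 𝔔`. [cite: NeukirchANT1999, Ch. I §9] -/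
theorem isArithFrobAt_conjRestrict (τ : M ≃ₐ[K] M) {w : HeightOneSpectrum (𝓞 K')} {Q : Ideal (𝓞 M)}
    (hQ : Q ∈ w.asIdeal.primesOver (𝓞 M)) {φ : M ≃ₐ[K'] M} (hφ : IsArithFrobAt (𝓞 K') φ Q) :
    IsArithFrobAt (𝓞 K') (conjRestrict τ φ) (τ • Q) := by
  have hunder : (τ • Q).under (𝓞 K') = (τ.restrictNormal K' • w).asIdeal :=
    ((smul_mem_primesOver τ hQ).2.over).symm
  have hunder₀ : Q.under (𝓞 K') = w.asIdeal := (hQ.2.over).symm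
  intro y
  rw [MulSemiringAction.toAlgHom_apply, hunder, HeightOneSpectrum.card_quotient_smul,
    conjRestrict_smul_ringOfIntegers]
  have h := hφ (τ⁻¹ • y)
  rw [MulSemiringAction.toAlgHom_apply, hunder₀] at h
  have heq : τ • (φ • (τ⁻¹ • y)) - y ^ Nat.card (𝓞 K' ⧸ w.asIdeal) =
      τ • (φ • (τ⁻¹ • y) - (τ⁻¹ • y) ^ Nat.card (𝓞 K' ⧸ w.asIdeal)) := by
    rw [smul_sub, smul_pow', smul_inv_smul]
  rw [heq]
  exact Ideal.smul_mem_pointwise_smul_iff.mpr h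

omit [FiniteDimensional K' M] in
/-- **`Frob_{σ w}(M|K') = τ Frob_w(M|K') τ⁻¹`** for `σ = τ|_{K'}` and `σ w` unramified in the abelian
`M|K'`. [cite: NeukirchANT1999, Ch. I §9] -/
theorem galFrob_galois_smul (τ : M ≃ₐ[K] M) {w : HeightOneSpectrum (𝓞 K')}
    (hunr : Algebra.IsUnramifiedIn (𝓞 M) (τ.restrictNormal K' • w).asIdeal) :
    galFrob K' M (τ.restrictNormal K' • w) = conjRestrict τ (galFrob K' M w) := by
  obtain ⟨Q, hQ, hφ⟩ := galFrob_spec K' M w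
  exact (eq_galFrob (fun a b => IsMulCommutative.is_comm.comm a b) hunr (smul_mem_primesOver τ hQ)
    (isArithFrobAt_conjRestrict τ hQ hφ)).symm

end Frobenius

/-! ### Galois equivariance of the Artin map -/

section Artin

variable (K : Type) [Field K] (K' : Type) [Field K'] [NumberField K'] [Algebra K K']
  (M : Type) [Field M] [NumberField M] [Algebra K M] [Algebra K' M] [IsScalarTower K K' M]
  [IsGalois K K'] [FiniteDimensional K' M] [IsAbelianGalois K' M]

omit [IsGalois K K'] in
variable {K K'} in
/-- **`ψ_{M|K'}(⟨ϖ⟩_w) = Frob_w`** for any uniformizer `ϖ` at a prime `w` of `K'` unramified in `M`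
(abstract `M`; transport of `artinIdeleMap_localUnits_of_valuation_eq`).
[cite: CasselsFrohlichANT1967, Ch. VII §4.2 Corollary (iii) (PDF p. 211)] -/
theorem artinIdeleMapOfAlgebra_localUnits_of_valuation_eq (hR : artinReciprocity_character)
    {w : HeightOneSpectrum (𝓞 K')} (hunr : Algebra.IsUnramifiedIn (𝓞 M) w.asIdeal)
    {ϖ : (w.adicCompletion K')ˣ} (hϖ : Valued.v (ϖ : w.adicCompletion K') = WithZero.exp (-1 : ℤ)) :
    artinIdeleMapOfAlgebra K' M hR (localUnits w ϖ) = galFrob K' M w := by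
  have hunr' : Algebra.IsUnramifiedIn (𝓞 (embeddedField K' M)) w.asIdeal :=
    (isUnramifiedIn_embeddedField_iff w).mpr hunr
  apply (embeddedEquiv K' M).autCongr.injective
  rw [autCongr_artinIdeleMapOfAlgebra, artinIdeleMap_localUnits_of_valuation_eq _ hR hunr' hϖ,
    galFrob_embeddedField_eq hunr]

/-- **Galois equivariance of the Artin map (Tate 11.5)**: for `τ ∈ Aut_K(M)` and `σ = τ|_{K'}`,
`ψ_{M|K'}(σ • x) = τ ψ_{M|K'}(x) τ⁻¹` on `𝕀_{K'}`.  Proof: `x ↦ τ⁻¹ ψ_{M|K'}(σ • x) τ` has open kernel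
(`σ` acts continuously), kills the principal ideles (`σ Kˣ' = K'ˣ`) and sends `⟨ϖ_w⟩` to
`τ⁻¹ Frob_{σ w} τ = Frob_w` for almost all `w`; by uniqueness it is `ψ_{M|K'}`.
[cite: CasselsFrohlichANT1967, Ch. VII Thm. 11.5 (PDF p. 236)] -/
theorem artinIdeleMapOfAlgebra_galois_smul (hR : artinReciprocity_character) (τ : M ≃ₐ[K] M)
    (x : ideleGroup K') :
    artinIdeleMapOfAlgebra K' M hR (τ.restrictNormal K' • x) =
      conjRestrict τ (artinIdeleMapOfAlgebra K' M hR x) := by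
  set σ : K' ≃ₐ[K] K' := τ.restrictNormal K' with hσ
  set ψ := artinIdeleMapOfAlgebra K' M hR with hψ
  let f : ideleGroup K' →* (M ≃ₐ[K'] M) :=
    (conjRestrictHom τ.symm).comp (ψ.comp (MulDistribMulAction.toMonoidHom (ideleGroup K') σ))
  have hf_apply : ∀ y, f y = conjRestrict τ.symm (ψ (σ • y)) := fun y => rfl
  have hf : f = ψ := by
    refine artinIdeleMapOfAlgebra_unique K' M hR f ?_ ?_ ?_
    · have hker : (f.ker : Set (ideleGroup K')) = (fun y => σ • y) ⁻¹' (ψ.ker : Set (ideleGroup K')) := by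
        ext y
        simp only [SetLike.mem_coe, MonoidHom.mem_ker, Set.mem_preimage, hf_apply,
          conjRestrict_eq_one_iff]
      rw [hker]
      exact (isOpen_ker_artinIdeleMapOfAlgebra K' M hR).preimage (ideleGroup_continuous_smul K K' σ)
    · intro y hy
      rw [hf_apply, conjRestrict_eq_one_iff]
      exact (MonoidHom.mem_ker).mp
        (principalIdeles_le_ker_artinIdeleMapOfAlgebra K' M hR (smul_mem_principalIdeles K K' σ hy))
    · have h1 : ∀ᶠ w : HeightOneSpectrum (𝓞 K') in cofinite,
          Algebra.IsUnramifiedIn (𝓞 M) w.asIdeal := by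
        rw [eventually_cofinite]
        exact finite_setOf_not_isUnramifiedIn K' M
      have h2 : ∀ᶠ w : HeightOneSpectrum (𝓞 K') in cofinite,
          Algebra.IsUnramifiedIn (𝓞 M) (σ • w).asIdeal :=
        (MulAction.injective (β := HeightOneSpectrum (𝓞 K')) σ).tendsto_cofinite.eventually h1
      filter_upwards [h1, h2] with w hw hσw
      rw [hf_apply, algEquiv_smul_localUnits K K' σ w,
        artinIdeleMapOfAlgebra_localUnits_of_valuation_eq M hR hσw
          (by rw [valued_galAdicCompletionUnitsEquiv]; exact HeckeCharacter.valued_uniformizer (K := K') (v := w)),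
        galFrob_galois_smul τ hσw, conjRestrict_symm_conjRestrict]
  have hx := DFunLike.congr_fun hf x
  rw [hf_apply] at hx
  rw [← hx, conjRestrict_conjRestrict_symm]

/-- **`ψ_{M|K'}(σ • x)|_K = τ ψ_{M|K'}(x)|_K τ⁻¹` in `Aut_K(M)`.**
[cite: CasselsFrohlichANT1967, Ch. VII Thm. 11.5 (PDF p. 236)] -/
theorem restrictScalars_artinIdeleMapOfAlgebra_galois_smul (hR : artinReciprocity_character)
    (τ : M ≃ₐ[K] M) (x : ideleGroup K') :
    (artinIdeleMapOfAlgebra K' M hR (τ.restrictNormal K' • x)).restrictScalars K =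
      τ * (artinIdeleMapOfAlgebra K' M hR x).restrictScalars K * τ⁻¹ := by
  rw [artinIdeleMapOfAlgebra_galois_smul K K' M hR τ x, AlgEquiv.restrictScalars_conjRestrict]

/-- **The norm group `K'ˣ N_{M|K'} 𝕀_M` is `G(K'|K)`-stable** when `M|K` is Galois: for
`σ ∈ G(K'|K)` (extended to `τ ∈ G(M|K)`), `σ • x ∈ ker ψ_{M|K'} ↔ x ∈ ker ψ_{M|K'}`.
[cite: CasselsFrohlichANT1967, Ch. VII §12, proof of the Lemma (PDF p. 239)] -/
theorem smul_mem_normGroup_iff [IsGalois K M] (hR : artinReciprocity_character) (σ : K' ≃ₐ[K] K')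
    (x : ideleGroup K') :
    σ • x ∈ Automorphic.normGroup K' M ↔ x ∈ Automorphic.normGroup K' M := by
  obtain ⟨τ, rfl⟩ := AlgEquiv.restrictNormalHom_surjective M σ
  change τ.restrictNormal K' • x ∈ _ ↔ _
  rw [← ker_artinIdeleMapOfAlgebra K' M hR, MonoidHom.mem_ker, MonoidHom.mem_ker,
    artinIdeleMapOfAlgebra_galois_smul K K' M hR τ x, conjRestrict_eq_one_iff]

/-- **If `M|K` is abelian, `ψ_{M|K'}` is `G(K'|K)`-invariant**: `ψ_{M|K'}(σ • x) = ψ_{M|K'}(x)`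
(conjugation by `τ` is trivial on the abelian `G(M|K) ⊇ G(M|K')`).
[cite: CasselsFrohlichANT1967, Ch. VII Thm. 11.5 (PDF p. 236)] -/
theorem artinIdeleMapOfAlgebra_galois_smul_eq [IsAbelianGalois K M] (hR : artinReciprocity_character)
    (σ : K' ≃ₐ[K] K') (x : ideleGroup K') :
    artinIdeleMapOfAlgebra K' M hR (σ • x) = artinIdeleMapOfAlgebra K' M hR x := by
  obtain ⟨τ, rfl⟩ := AlgEquiv.restrictNormalHom_surjective M σ
  change artinIdeleMapOfAlgebra K' M hR (τ.restrictNormal K' • x) = _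
  rw [artinIdeleMapOfAlgebra_galois_smul K K' M hR τ x]
  apply AlgEquiv.restrictScalars_injective K
  rw [AlgEquiv.restrictScalars_conjRestrict, (IsMulCommutative.is_comm.comm τ _), mul_inv_cancel_right]

end Artin

end Literature.NumberTheory.GaloisRepresentations

end
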